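import Summits.QuantumFields.YangMills.Theorems.BalabanUVNodesN06AtRecord11ObligationsS349
import Literature.MathematicalPhysics.QuantumFieldTheory.Balaban1983to89.B9Eq3132Whole
import Literature.MathematicalPhysics.QuantumFieldTheory.Balaban1983to89.B9ResidualEntriesAtOne
import Literature.MathematicalPhysics.QuantumFieldTheory.Balaban1983to89.B9Cor35ComparisonsGA
import Literature.MathematicalPhysics.QuantumFieldTheory.Balaban1983to89.B9Thm39Whole

/-!
# BalabanUVNodes ∕ N06 ([B9], `Dag.B9_main`) — OBLIGATIONS OF THE STAGE-11 CERTIFICATE KNIT AT THE RECORD, IX (batch):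
# rows 4–8 (`hGA_*`, n06-g), 11–12 (`hGp`, `hGA` residual-at-one, n06-h), 15–16 (`t39`, `hksum`, n06-j), 26 (`s3132`, n06-i) SUPPLIED BY NAME

Track A of `YM-PLAN.md` (cell `pub-ymgap`, HUMAN RULING D-0062), node **N06** = [Balaban1985BackgroundPropagators] Thms 3.1–3.15; seat
`pub-ymgap-dag-n06-d` gen 2 = dag-lead N06-ASSIGNMENT v1 (P3) «THE KNIT AT THE RECORD».  Sequel of `BalabanUVNodesN06AtRecord11ObligationsS349` (p463290).

WHAT IS SUPPLIED, AND FROM WHAT (all suppliers' theorems consumed BY NAME at `I := MemberY`, `geo9Y`, `bg9Y (M_N ℂ) SU(N)`, `c35Y`):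
* rows 4–8 `hGA_e hGA_h1 hGA_e4 hGA_h2 hGA_l2` — seat n06-g's `B9Cor35ComparisonsGA.hGA_*_of_pin` (p-landed 19:16Z): the layer's `G(U)` family PINNED to the letters
  `(ops x).GA = GAOfOps (𝔬ga x)` with the letters [4]'s at `U = 1` (`(𝔬ga x).AtOne`, Cor. 3.5 p. 407 «for U = 1 these theorems are proved in [4]»).
* rows 11–12 `hGp : ResidualGpAtOne`, `hGA : ResidualGAGlobAtOne` — seat n06-h's `B9ResidualEntriesAtOne.hGp_of_blocksOn_of_null` ∕ `hGA_of_globOn_of_null` (p461455):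
  the per-block `U = 1` leaves of G′(1) ON site arguments (`AtOneL2On`, `AtOneGlobOn`, `AtOneH1On`, `AtOneE4On`, `AtOneH2On`, cell GAPS G-B9-03a) and of G(1)'s (3.47) ON
  bond arguments (G-A1-1 (b)), + the null readings off the summand (G′: displayed; G: by `rfl` at the `GAOfOps` pin, whose readings are `0` on site arguments).
* rows 15–16 `t39 : B9.Thm39Printed …`, `hksum : B9.RWKernelSumYields …` — seat n06-j's `B9Thm39Whole.thm39Printed_of_local348` ∕ `rwKernelSumYields_of_conv348` (p462736)
  at the LITERAL pin `(ops x).EK39 = EK39OfOps (𝔬39 x) (rd39 x) (θ.d₆+1) B₁′ δ₁′` (the leaf reads the walk data), from the schemas `StaticOK39`, `Locality39`, the two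
  (2.61)'s, «Cor. 3.6 ∕ (3.95) identities ∕ smallness (2.85) ∕ factor bounds (3.89)» at U, and the kernel reading `KerReads` of `(ops x).Cinv`.
* row 26 `s3132 : B9.Stmt3132Printed …` — seat n06-i's `B9Eq3132Whole.stmt3132Printed_of_coercive` (p462308): Combes–Thomas inputs `CTInputs` ×2, the normalisation
  readings `InvNormalised` of `(ops x).QGQinv ∕ .QG1Qinv`, the weights transfer; its four carrier facts (symmetric ∕ reflexive ∕ triangle distance, `Lʲη ≥ 0`)
  DISCHARGED on the record's k-level tori (`B9GeoNormsKLevelV1.distT_self`, `B6Geom246MultiLevelTorus.triangle_refl_nonneg_T`, `SimpleGraph.dist_comm`, `len_pos`).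

WHAT THIS MODULE DOES (kernel bookkeeping; 0 `def`, 0 `sorry`, standard axioms; COUNT-NEUTRAL, `--supports` K1 `StabilityBAtRecordR11e`):
* `b9_main_of_up_view₁₁B10YZW_of_obligations_batch2supplied` — the chain of record with those ten binders REPLACED by the suppliers' displayed hypotheses:
  9 operator-layer obligations of the original certificate remain verbatim (`hGp_e hGp_h1 hC t310 t311 t312 t313 t315 t314loc`).

HONEST FRAMING.  Every supplied row is supplied MODULO displayed hypothesis schemas of printed ∕ located shape (pins, letters-at-one, per-block U = 1 leaves, readings);
nothing of [B9] is proved for Bałaban's operators; no `OpsY` ∕ `Ops` instance over the record's lattice operators exists in the tree (def-Y's `opsYOfLetters` pending);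
k stays 0 ∕ 28 in the referee's sense; N06 is NOT discharged.  One finite four-torus programme at fixed `ε` — NOT ℝ⁴, NOT OS, NOT a mass gap, NOT Clay.  No `def`.
-/

noncomputable section

namespace Summit.QuantumFields.YangMills.BalabanUVNodes.N06AtRecord11ObligationsBatch2

open Literature.MathematicalPhysics.QuantumFieldTheory.Balaban1983to89
open Literature.MathematicalPhysics.QuantumFieldTheory.Balaban1983to89.T4Continuum (T4Family FiniteEpsData)
open Literature.MathematicalPhysics.QuantumFieldTheory.Balaban1983to89.DagBinding (WorldP leavesP B9LeafX)
open Literature.MathematicalPhysics.QuantumFieldTheory.Balaban1983to89.Node00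
open Literature.MathematicalPhysics.QuantumFieldTheory.Balaban1983to89.B9PinMembersKLevelV1 (MemberY geo9Y bg9Y)
open Literature.MathematicalPhysics.QuantumFieldTheory.Balaban1983to89.B9PinGeometryKLevelV1 (dOmegaY OmKY inΛY unitDistY InCubeY c35Y c35Y_pos)
open Literature.MathematicalPhysics.QuantumFieldTheory.Balaban1983to89.B7Prop2SpecialUnitary (specialUnitaryUnits)
open Literature.MathematicalPhysics.QuantumFieldTheory.Balaban1983to89.B9Thm37Whole (Ops Conv342 Sizes StaticOK Local342 Identities const37)
open Literature.MathematicalPhysics.QuantumFieldTheory.Balaban1983to89.B9Cor38Whole (WalkReading Locality W38OfOps)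
open Literature.MathematicalPhysics.QuantumFieldTheory.Balaban1983to89.B9Thm37GlueCor36 (CoRealizes)
open Literature.MathematicalPhysics.QuantumFieldTheory.Balaban1983to89.B6RandomWalk (Ineq261)
open Literature.MathematicalPhysics.QuantumFieldTheory.Balaban1983to89.B9Thm34Ext (toB6)
open Literature.MathematicalPhysics.QuantumFieldTheory.Balaban1983to89.B9Thm314 (Thm314LocalPrinted IneqSupF)
open Literature.MathematicalPhysics.QuantumFieldTheory.Balaban1983to89.B9SectBStepWhole
  (StepE StepL2n StepGlob StepH1 StepE4 StepH2 StepKer StepAnalytic)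
open Literature.MathematicalPhysics.QuantumFieldTheory.Balaban1983to89.B9Ineq349Whole (Dict349 DistOK LevelGap RowSum261)
open Literature.MathematicalPhysics.QuantumFieldTheory.Balaban1983to89.B9Eq3132Whole (CTInputs InvNormalised WeightsTransfer stmt3132Printed_of_coercive)
open Literature.MathematicalPhysics.QuantumFieldTheory.Balaban1983to89.B9ResidualEntriesAtOne
  (AtOneL2On AtOneGlobOn AtOneH1On AtOneE4On AtOneH2On hGp_of_blocksOn_of_null hGA_of_globOn_of_null)
open Literature.MathematicalPhysics.QuantumFieldTheory.Balaban1983to89.B9Cor35ComparisonsGA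
  (GAOps GAOfOps hGA_e_of_pin hGA_h1_of_pin hGA_e4_of_pin hGA_h2_of_pin hGA_l2_of_pin)
open Literature.MathematicalPhysics.QuantumFieldTheory.Balaban1983to89.B9Thm39Whole
  (Ops39 WalkReading39 EK39OfOps StaticOK39 Local348 Identities395 Small285 Factors389 Locality39 KerReads thm39Printed_of_local348 rwKernelSumYields_of_conv348)
open Literature.MathematicalPhysics.QuantumFieldTheory.Balaban1983to89.B6KLevelCensusIndexV1 (len_pos)
open Literature.MathematicalPhysics.QuantumFieldTheory.Balaban1983to89.B9GeoNormsKLevelV1 (distT_self)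
open Literature.MathematicalPhysics.QuantumFieldTheory.Balaban1983to89.B6Ineq2142KLevelV1 (β)
open Summit.QuantumFields.YangMills.BalabanUVNodes.N06AtRecord11ObligationsS349 (b9_main_of_up_view₁₁B10YZW_of_obligations_W38T314SectBnHgEHS349supplied)
open scoped Matrix.Norms.L2Operator

variable {N : ℕ}

/-! ## THE KNIT AT ₁₁ — the chain of record with rows 4–8, 11–12, 15–16, 26 supplied -/

section Pointed

variable [NeZero N] {F : T4Family}

/-- **THE CHAIN OF RECORD WITH ROWS 4–8, 11–12, 15–16, 26 SUPPLIED** (suppliers n06-g, n06-h, n06-j, n06-i — see the module docstring): `Dag.B9_main` at every run of a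
world bound over the four-pin Stage-11 view FROM 9 of the original operator-layer obligations verbatim (`hGp_e hGp_h1 hC t310 t311 t312 t313 t315 t314loc`), the `GAOfOps`
pin + `AtOne`, G′(1)'s per-block leaves on site arguments + null readings on bond arguments, G(1)'s (3.47) leaf on bond arguments, the `EK39OfOps` pin + its schemas +
`KerReads`, the Combes–Thomas ∕ normalisation ∕ weights-transfer inputs of (3.132), `hdict` + the three record-geometry facts of row 25, and the rest of the chain's displayed
schemas (walk pin, co-readings, residual, (β)(γ), 24 Sect.-B steps).  Row 26's four carrier facts are DISCHARGED here.  Displayed and nothing else; NOT a discharge of N06.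
[cite: Balaban1985BackgroundPropagators, Cor. 3.5 p.407, Thm 3.9 (3.98)–(3.99) p.413, (3.132) p.422, (3.42)–(3.48) pp.397–398; Balaban1984PropagatorsII, Prop. 2.6 (2.136)–(2.140) p.247, Lemma 2.1 (2.61) p.234] -/
theorem b9_main_of_up_view₁₁B10YZW_of_obligations_batch2supplied (θ : Stage11Params F N) (hθ : θ.Admissible) (Mstar : ℕ)
    (ops : OpsY N θ.toStage3Params Mstar) (ζ : ResidZ F N) (lamW : ResidW F N) (w : WorldP)
    (hup : ∀ P, w.up P = upOfRecord₅C F N (θ.view₁₁B10YZW F N Mstar ops ζ lamW) P)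
    (hGp_e : ∀ (x : MemberY θ.d₆ θ.ℓ₆ θ.hd' θ.hL' θ.b₀ θ.b₁ Mstar) (n : Fin 4) (lam : (geo9Y x).Loc) (y : (geo9Y x).Site),
      (ops x).Gp.e n (bg9Y (Matrix (Fin N) (Fin N) ℂ) (specialUnitaryUnits (Fin N)) x).one lam y ≤ (Node00.GpU x.toKIdx).e n lam y)
    (hGp_h1 : ∀ (x : MemberY θ.d₆ θ.ℓ₆ θ.hd' θ.hL' θ.b₀ θ.b₁ Mstar) (lam : (geo9Y x).Loc) (b : ℝ) (c : (geo9Y x).Cut),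
      (ops x).Gp.h1 (bg9Y (Matrix (Fin N) (Fin N) ℂ) (specialUnitaryUnits (Fin N)) x).one lam b c ≤ (Node00.GpU x.toKIdx).h1 lam b c)
    (hC : ∀ (x : MemberY θ.d₆ θ.ℓ₆ θ.hd' θ.hL' θ.b₀ θ.b₁ Mstar) (y y' : (geo9Y x).Site),
      |(ops x).Cinv.ker (bg9Y (Matrix (Fin N) (Fin N) ℂ) (specialUnitaryUnits (Fin N)) x).one y y'| ≤ |(Node00.CinvU x.toKIdx).ker y y'|)
    -- in place of `hB`: n06-c's fourteen printed block-steps of Sect. B (§1)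
    (hA : StepAnalytic (θ.d₆ + 1) c35Y geo9Y (bg9Y (Matrix (Fin N) (Fin N) ℂ) (specialUnitaryUnits (Fin N))) (fun x => (ops x).Gp) (fun x => (ops x).GA)
      (fun x => (ops x).Cinv) (fun x => (ops x).IsAnalyticExt))
    (hEp : StepE (θ.d₆ + 1) c35Y geo9Y (bg9Y (Matrix (Fin N) (Fin N) ℂ) (specialUnitaryUnits (Fin N))) (fun x => (ops x).Gp) (fun x => (ops x).GA)
      (fun x => (ops x).Cinv) (fun x => (ops x).Gp))
    (hLp : ∀ n : Fin 6, StepL2n (θ.d₆ + 1) c35Y geo9Y (bg9Y (Matrix (Fin N) (Fin N) ℂ) (specialUnitaryUnits (Fin N))) (fun x => (ops x).Gp) (fun x => (ops x).GA)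
      (fun x => (ops x).Cinv) (fun x => (ops x).Gp) n)
    (hGlp : StepGlob (θ.d₆ + 1) c35Y geo9Y (bg9Y (Matrix (Fin N) (Fin N) ℂ) (specialUnitaryUnits (Fin N))) (fun x => (ops x).Gp) (fun x => (ops x).GA)
      (fun x => (ops x).Cinv) (fun x => (ops x).Gp))
    (hH1p : StepH1 (θ.d₆ + 1) c35Y geo9Y (bg9Y (Matrix (Fin N) (Fin N) ℂ) (specialUnitaryUnits (Fin N))) (fun x => (ops x).Gp) (fun x => (ops x).GA)
      (fun x => (ops x).Cinv) (fun x => (ops x).Gp))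
    (hE4p : StepE4 (θ.d₆ + 1) c35Y geo9Y (bg9Y (Matrix (Fin N) (Fin N) ℂ) (specialUnitaryUnits (Fin N))) (fun x => (ops x).Gp) (fun x => (ops x).GA)
      (fun x => (ops x).Cinv) (fun x => (ops x).Gp))
    (hH2p : StepH2 (θ.d₆ + 1) c35Y geo9Y (bg9Y (Matrix (Fin N) (Fin N) ℂ) (specialUnitaryUnits (Fin N))) (fun x => (ops x).Gp) (fun x => (ops x).GA)
      (fun x => (ops x).Cinv) (fun x => (ops x).Gp))
    (hK : StepKer (θ.d₆ + 1) c35Y geo9Y (bg9Y (Matrix (Fin N) (Fin N) ℂ) (specialUnitaryUnits (Fin N))) (fun x => (ops x).Gp) (fun x => (ops x).GA)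
      (fun x => (ops x).Cinv) (fun x => (ops x).Cinv))
    (hEa : StepE (θ.d₆ + 1) c35Y geo9Y (bg9Y (Matrix (Fin N) (Fin N) ℂ) (specialUnitaryUnits (Fin N))) (fun x => (ops x).Gp) (fun x => (ops x).GA)
      (fun x => (ops x).Cinv) (fun x => (ops x).GA))
    (hLa : ∀ n : Fin 6, StepL2n (θ.d₆ + 1) c35Y geo9Y (bg9Y (Matrix (Fin N) (Fin N) ℂ) (specialUnitaryUnits (Fin N))) (fun x => (ops x).Gp) (fun x => (ops x).GA)
      (fun x => (ops x).Cinv) (fun x => (ops x).GA) n)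
    (hGla : StepGlob (θ.d₆ + 1) c35Y geo9Y (bg9Y (Matrix (Fin N) (Fin N) ℂ) (specialUnitaryUnits (Fin N))) (fun x => (ops x).Gp) (fun x => (ops x).GA)
      (fun x => (ops x).Cinv) (fun x => (ops x).GA))
    (hH1a : StepH1 (θ.d₆ + 1) c35Y geo9Y (bg9Y (Matrix (Fin N) (Fin N) ℂ) (specialUnitaryUnits (Fin N))) (fun x => (ops x).Gp) (fun x => (ops x).GA)
      (fun x => (ops x).Cinv) (fun x => (ops x).GA))
    (hE4a : StepE4 (θ.d₆ + 1) c35Y geo9Y (bg9Y (Matrix (Fin N) (Fin N) ℂ) (specialUnitaryUnits (Fin N))) (fun x => (ops x).Gp) (fun x => (ops x).GA)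
      (fun x => (ops x).Cinv) (fun x => (ops x).GA))
    (hH2a : StepH2 (θ.d₆ + 1) c35Y geo9Y (bg9Y (Matrix (Fin N) (Fin N) ℂ) (specialUnitaryUnits (Fin N))) (fun x => (ops x).Gp) (fun x => (ops x).GA)
      (fun x => (ops x).Cinv) (fun x => (ops x).GA))
    -- in place of `t37`, `c38`, `hsum`: as in sequel II
    [∀ x : MemberY θ.d₆ θ.ℓ₆ θ.hd' θ.hL' θ.b₀ θ.b₁ Mstar, Fintype (geo9Y x).Site]
    [∀ x : MemberY θ.d₆ θ.ℓ₆ θ.hd' θ.hL' θ.b₀ θ.b₁ Mstar, DecidableEq (geo9Y x).Site]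
    {X Y ι : MemberY θ.d₆ θ.ℓ₆ θ.hd' θ.hL' θ.b₀ θ.b₁ Mstar → Type}
    [∀ x, Fintype (X x)] [∀ x, DecidableEq (X x)] [∀ x, Fintype (Y x)] [∀ x, DecidableEq (Y x)] [∀ x, Fintype (ι x)]
    -- rows 4–8 (seat n06-g): the layer's G(U) family pinned to the letters, the letters [4]'s at U = 1
    {W2 S2 : MemberY θ.d₆ θ.ℓ₆ θ.hd' θ.hL' θ.b₀ θ.b₁ Mstar → Type} [∀ x, NormedAddCommGroup (W2 x)] [∀ x, NormedSpace ℝ (W2 x)]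
    (𝔬ga : ∀ x : MemberY θ.d₆ θ.ℓ₆ θ.hd' θ.hL' θ.b₀ θ.b₁ Mstar, GAOps (W2 x) (S2 x) x.toKIdx (bg9Y (Matrix (Fin N) (Fin N) ℂ) (specialUnitaryUnits (Fin N)) x))
    (hpinGA : ∀ x : MemberY θ.d₆ θ.ℓ₆ θ.hd' θ.hL' θ.b₀ θ.b₁ Mstar, (ops x).GA = GAOfOps (𝔬ga x)) (hAtOne : ∀ x : MemberY θ.d₆ θ.ℓ₆ θ.hd' θ.hL' θ.b₀ θ.b₁ Mstar, (𝔬ga x).AtOne)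
    -- rows 11–12 (seat n06-h): G′(1)'s per-block leaves ON site arguments + null readings on bond arguments; G(1)'s (3.47) leaf ON bond arguments
    (hnullL2 : ∀ (x : MemberY θ.d₆ θ.ℓ₆ θ.hd' θ.hL' θ.b₀ θ.b₁ Mstar) (n : Fin 6) (lam : (geo9Y x).Loc) (h : (geo9Y x).Cut), lam.isRight = true →
      (ops x).Gp.l2 n (bg9Y (Matrix (Fin N) (Fin N) ℂ) (specialUnitaryUnits (Fin N)) x).one lam h ≤ 0)
    (hnullG : ∀ (x : MemberY θ.d₆ θ.ℓ₆ θ.hd' θ.hL' θ.b₀ θ.b₁ Mstar) (n : Fin 4) (lam : (geo9Y x).Loc) (γ : ℝ), lam.isRight = true →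
      (ops x).Gp.glob n (bg9Y (Matrix (Fin N) (Fin N) ℂ) (specialUnitaryUnits (Fin N)) x).one lam γ ≤ 0)
    (hnullE4 : ∀ (x : MemberY θ.d₆ θ.ℓ₆ θ.hd' θ.hL' θ.b₀ θ.b₁ Mstar) (lam : (geo9Y x).Loc) (y : (geo9Y x).Site), lam.isRight = true →
      (ops x).Gp.e4 (bg9Y (Matrix (Fin N) (Fin N) ℂ) (specialUnitaryUnits (Fin N)) x).one lam y ≤ 0)
    (hnullH2 : ∀ (x : MemberY θ.d₆ θ.ℓ₆ θ.hd' θ.hL' θ.b₀ θ.b₁ Mstar) (lam : (geo9Y x).Loc) (b : ℝ) (ζ : (geo9Y x).Cut), lam.isRight = true →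
      (ops x).Gp.h2 (bg9Y (Matrix (Fin N) (Fin N) ℂ) (specialUnitaryUnits (Fin N)) x).one lam b ζ ≤ 0)
    (hGpL2 : AtOneL2On geo9Y (bg9Y (Matrix (Fin N) (Fin N) ℂ) (specialUnitaryUnits (Fin N))) (fun x => (ops x).Gp) (fun _ lam => ¬ (lam.isRight = true)))
    (hGpG : AtOneGlobOn geo9Y (bg9Y (Matrix (Fin N) (Fin N) ℂ) (specialUnitaryUnits (Fin N))) (fun x => (ops x).Gp) (fun _ lam => ¬ (lam.isRight = true)))
    (hGpH1 : AtOneH1On geo9Y (bg9Y (Matrix (Fin N) (Fin N) ℂ) (specialUnitaryUnits (Fin N))) (fun x => (ops x).Gp) (fun _ lam => ¬ (lam.isRight = true)))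
    (hGpE4 : AtOneE4On geo9Y (bg9Y (Matrix (Fin N) (Fin N) ℂ) (specialUnitaryUnits (Fin N))) (fun x => (ops x).Gp) (fun _ lam => ¬ (lam.isRight = true)))
    (hGpH2 : AtOneH2On geo9Y (bg9Y (Matrix (Fin N) (Fin N) ℂ) (specialUnitaryUnits (Fin N))) (fun x => (ops x).Gp) (fun _ lam => ¬ (lam.isRight = true)))
    (hGAG : AtOneGlobOn geo9Y (bg9Y (Matrix (Fin N) (Fin N) ℂ) (specialUnitaryUnits (Fin N))) (fun x => (ops x).GA) (fun _ lam => lam.isRight = true))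
    -- rows 15–16 (seat n06-j): the (3.98) expansion pinned to the letters of Q′G′²Q′*, its schemas, the kernel reading of (Q′G′²Q′*)⁻¹
    {ι39 κ39 : MemberY θ.d₆ θ.ℓ₆ θ.hd' θ.hL' θ.b₀ θ.b₁ Mstar → Type} [∀ x, Fintype (ι39 x)]
    (𝔬39 : ∀ x : MemberY θ.d₆ θ.ℓ₆ θ.hd' θ.hL' θ.b₀ θ.b₁ Mstar, Ops39 (geo9Y x) (bg9Y (Matrix (Fin N) (Fin N) ℂ) (specialUnitaryUnits (Fin N)) x) (ι39 x) (κ39 x))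
    (rd39 : ∀ x : MemberY θ.d₆ θ.ℓ₆ θ.hd' θ.hL' θ.b₀ θ.b₁ Mstar, WalkReading39 (bg9Y (Matrix (Fin N) (Fin N) ℂ) (specialUnitaryUnits (Fin N)) x) (ι39 x) (κ39 x))
    (R39 : MemberY θ.d₆ θ.ℓ₆ θ.hd' θ.hL' θ.b₀ θ.b₁ Mstar → ℝ) (H39 : MemberY θ.d₆ θ.ℓ₆ θ.hd' θ.hL' θ.b₀ θ.b₁ Mstar → Prop) (α39 α' r39 δ39 θ39 B39 N39 a39 M39 ML39 : ℝ)
    (h39α : 0 ≤ α39) (h39α1 : α39 < 1) (hα' : α' ≤ 1) (hr39 : 0 ≤ r39) (hrδ39 : r39 ≤ δ39) (hδ39 : 0 < δ39) (hθ39 : 0 ≤ θ39)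
    (hB39 : 0 < B39) (hN39 : 0 ≤ N39) (ha39 : 0 < a39) (hM39 : 0 < M39)
    (hst39 : ∀ x, StaticOK39 (𝔬39 x) N39) (hloc39 : ∀ x, Locality39 (𝔬39 x) (rd39 x))
    (h261_39 : ∀ x : MemberY θ.d₆ θ.ℓ₆ θ.hd' θ.hL' θ.b₀ θ.b₁ Mstar, ML39 ≤ (geo9Y x).M →
      Ineq261 (θ.d₆ + 1) (toB6 (geo9Y x) (R39 x) (H39 x)) δ39 α39 ∧ Ineq261 (θ.d₆ + 1) (toB6 (geo9Y x) (R39 x) (H39 x)) r39 α')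
    (h39 : ∀ x : MemberY θ.d₆ θ.ℓ₆ θ.hd' θ.hL' θ.b₀ θ.b₁ Mstar, M39 ≤ (geo9Y x).M → ∀ α₀ : ℝ, 0 < α₀ → c35Y * (geo9Y x).M * α₀ ≤ a39 →
      ∀ U : (bg9Y (Matrix (Fin N) (Fin N) ℂ) (specialUnitaryUnits (Fin N)) x).Cfg, (bg9Y (Matrix (Fin N) (Fin N) ℂ) (specialUnitaryUnits (Fin N)) x).Reg335 c35Y α₀ U →
        Local348 (𝔬39 x) (θ.d₆ + 1) B39 δ39 U ∧ Identities395 (𝔬39 x) U ∧ Small285 (𝔬39 x) (θ.d₆ + 1) θ39 r39 U ∧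
          Factors389 (𝔬39 x) (θ.d₆ + 1) θ39 δ39 U)
    (hEK39 : ∀ x : MemberY θ.d₆ θ.ℓ₆ θ.hd' θ.hL' θ.b₀ θ.b₁ Mstar, (ops x).EK39 = EK39OfOps (𝔬39 x) (rd39 x) (θ.d₆ + 1) (2 * (N39 * B39) * B6.c1 (θ.d₆ + 1) r39 α') ((1 - α') * r39))
    (hB₁39 : 0 < 2 * (N39 * B39) * B6.c1 (θ.d₆ + 1) r39 α') (hδ₁39 : 0 < (1 - α') * r39)
    (hrdC : ∀ x : MemberY θ.d₆ θ.ℓ₆ θ.hd' θ.hL' θ.b₀ θ.b₁ Mstar, KerReads (𝔬39 x) (ops x).Cinv (θ.d₆ + 1))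
    -- row 26 (seat n06-i): Combes–Thomas inputs, normalisation readings of (QGQ*)⁻¹ ∕ (QG₁Q*)⁻¹, weights transfer
    {S32 S32₁ : ∀ x : MemberY θ.d₆ θ.ℓ₆ θ.hd' θ.hL' θ.b₀ θ.b₁ Mstar, (bg9Y (Matrix (Fin N) (Fin N) ℂ) (specialUnitaryUnits (Fin N)) x).Cfg → Matrix (geo9Y x).Site (geo9Y x).Site ℝ}
    {w32 w32₁ : ∀ x : MemberY θ.d₆ θ.ℓ₆ θ.hd' θ.hL' θ.b₀ θ.b₁ Mstar, (geo9Y x).Site → ℝ}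
    (hCT : CTInputs c35Y geo9Y (bg9Y (Matrix (Fin N) (Fin N) ℂ) (specialUnitaryUnits (Fin N))) S32) (hCT₁ : CTInputs c35Y geo9Y (bg9Y (Matrix (Fin N) (Fin N) ℂ) (specialUnitaryUnits (Fin N))) S32₁)
    (hN32 : ∀ x : MemberY θ.d₆ θ.ℓ₆ θ.hd' θ.hL' θ.b₀ θ.b₁ Mstar, InvNormalised (ops x).QGQinv (S32 x) (w32 x)) (hN32₁ : ∀ x : MemberY θ.d₆ θ.ℓ₆ θ.hd' θ.hL' θ.b₀ θ.b₁ Mstar, InvNormalised (ops x).QG1Qinv (S32₁ x) (w32₁ x))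
    {A32 : ℝ} (hA32 : 0 < A32)
    (hwt : ∀ ε : ℝ, 0 < ε → ∃ Mw : ℝ, ∀ x : MemberY θ.d₆ θ.ℓ₆ θ.hd' θ.hL' θ.b₀ θ.b₁ Mstar, Mw ≤ (geo9Y x).M →
      WeightsTransfer (geo9Y x) (θ.d₆ + 1) (w32 x) ε A32 ∧ WeightsTransfer (geo9Y x) (θ.d₆ + 1) (w32₁ x) ε A32)
    (𝔬 : ∀ x, Ops (geo9Y x) (bg9Y (Matrix (Fin N) (Fin N) ℂ) (specialUnitaryUnits (Fin N)) x) (X x) (Y x) (ι x))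
    (rd : ∀ x, WalkReading (geo9Y x) (bg9Y (Matrix (Fin N) (Fin N) ℂ) (specialUnitaryUnits (Fin N)) x) (X x) (ι x))
    (R : MemberY θ.d₆ θ.ℓ₆ θ.hd' θ.hL' θ.b₀ θ.b₁ Mstar → ℝ) (H : MemberY θ.d₆ θ.ℓ₆ θ.hd' θ.hL' θ.b₀ θ.b₁ Mstar → Prop)
    (κ : MemberY θ.d₆ θ.ℓ₆ θ.hd' θ.hL' θ.b₀ θ.b₁ Mstar → Sizes) (d : ℕ) (α ρ Nc N' Cℓ K θ₀ B₀ δ₀ a₁ M₁ ML : ℝ)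
    (hα : 0 ≤ α) (hα2 : α ≤ 1 / 2) (hN : 0 ≤ Nc) (hN' : 0 ≤ N') (hCℓ : 1 ≤ Cℓ) (hK0 : 0 ≤ K) (hθ₀ : 0 ≤ θ₀) (hB₀ : 0 < B₀) (hδ₀ : 0 < δ₀)
    (ha₁ : 0 < a₁) (hM₁ : 0 < M₁)
    (hst : ∀ x, StaticOK (𝔬 x) ρ Nc N' Cℓ (κ x)) (hκ : ∀ x, (κ x).Bounded K θ₀ Cℓ (geo9Y x).M)
    (hrd : ∀ x, (rd x).OK (𝔬 x).blk) (hloc : ∀ x, Locality (𝔬 x) (rd x))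
    (h261 : ∀ x, ML ≤ (geo9Y x).M → Ineq261 d (toB6 (geo9Y x) (R x) (H x)) δ₀ α)
    (h36 : ∀ x, M₁ ≤ (geo9Y x).M → ∀ α₀ : ℝ, 0 < α₀ → c35Y * (geo9Y x).M * α₀ ≤ a₁ →
      ∀ U : (bg9Y (Matrix (Fin N) (Fin N) ℂ) (specialUnitaryUnits (Fin N)) x).Cfg,
        (bg9Y (Matrix (Fin N) (Fin N) ℂ) (specialUnitaryUnits (Fin N)) x).Reg335 c35Y α₀ U →
          Local342 (𝔬 x) (R x) (H x) B₀ δ₀ U ∧ Identities (𝔬 x) (R x) (H x) U)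
    (hE38 : ∀ x, (ops x).E37 = W38OfOps (𝔬 x) (rd x) (R x) (H x) (const37 d δ₀ α ρ B₀ Nc N' Cℓ K) ((1 - 2 * α) * δ₀))
    (evY : ∀ x : MemberY θ.d₆ θ.ℓ₆ θ.hd' θ.hL' θ.b₀ θ.b₁ Mstar, (geo9Y x).Loc → Y x → ℝ)
    (hco0 : ∀ x U, CoRealizes (ops x).Gp 0 U (𝔬 x).blk (𝔬 x).blk (rd x).ev ((𝔬 x).Gp U))
    (hco1 : ∀ x U, CoRealizes (ops x).Gp 1 U (𝔬 x).blkY (𝔬 x).blk (rd x).ev ((𝔬 x).D U ∘ₗ (𝔬 x).Gp U))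
    (hco2 : ∀ x U, CoRealizes (ops x).Gp 2 U (𝔬 x).blk (𝔬 x).blkY (evY x) ((𝔬 x).Gp U ∘ₗ (𝔬 x).Dstar U))
    (hco3 : ∀ x U, CoRealizes (ops x).Gp 3 U (𝔬 x).blk (𝔬 x).blk (rd x).ev ((𝔬 x).Lap U ∘ₗ (𝔬 x).Gp U))
    {B₁ δ₁ : ℝ} (hB₁ : 0 < B₁) (hδ₁ : 0 < δ₁) (hCB : const37 d δ₀ α ρ B₀ Nc N' Cℓ K ≤ B₁) (hδ₁le : δ₁ ≤ (1 - 2 * α) * δ₀)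
    {Bβ Bε : ℝ → ℝ} {Bεβ : ℝ → ℝ → ℝ}
    (hrest : ∀ (x : MemberY θ.d₆ θ.ℓ₆ θ.hd' θ.hL' θ.b₀ θ.b₁ Mstar) (U : (bg9Y (Matrix (Fin N) (Fin N) ℂ) (specialUnitaryUnits (Fin N)) x).Cfg),
      ((ops x).E37).Converges U →
        (∀ (n : Fin 6) (lam : (geo9Y x).Loc) (h : (geo9Y x).Cut) (y y' : (geo9Y x).Site), (geo9Y x).cutIn h y → (geo9Y x).suppIn lam y' →
            (ops x).Gp.l2 n U lam h ≤ B₁ * B9.pref6 ((geo9Y x).len y) n * (geo9Y x).cutSup h * Real.exp (-(δ₁ * (geo9Y x).dist y y')) * (geo9Y x).l2Norm lam) ∧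
        (∀ (n : Fin 4) (lam : (geo9Y x).Loc) (γ : ℝ), -4 ≤ γ → γ ≤ 4 → (ops x).Gp.glob n U lam γ ≤ B₁ * (geo9Y x).wNorm γ lam) ∧
        B9.Ineq343_345 (ops x).Gp Bβ Bε Bεβ δ₁ U)
    (h310 : ∀ (x : MemberY θ.d₆ θ.ℓ₆ θ.hd' θ.hL' θ.b₀ θ.b₁ Mstar) (U : (bg9Y (Matrix (Fin N) (Fin N) ℂ) (specialUnitaryUnits (Fin N)) x).Cfg),
      ((ops x).E310).Converges U → B9.Ineq342_346_347 (ops x).GA B₁ δ₁ U ∧ B9.Ineq343_345 (ops x).GA Bβ Bε Bεβ δ₁ U)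
    -- in place of `t314`: (γ) and (β) of sequel III
    (r : ℝ)
    (hgeo : ∀ (x : MemberY θ.d₆ θ.ℓ₆ θ.hd' θ.hL' θ.b₀ θ.b₁ Mstar) (y y' : (geo9Y x).Site), ¬ (OmKY x y ∧ OmKY x y') →
      dOmegaY x y y' ≤ (geo9Y x).dist y y' + r)
    (hplain : ∃ M₁ δ₁ a₁ B₁ : ℝ, 0 < M₁ ∧ 0 < δ₁ ∧ 0 < a₁ ∧ 0 < B₁ ∧
      ∀ x : MemberY θ.d₆ θ.ℓ₆ θ.hd' θ.hL' θ.b₀ θ.b₁ Mstar, M₁ ≤ (geo9Y x).M → ∀ α₀ : ℝ, 0 < α₀ → (geo9Y x).M * α₀ ≤ a₁ →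
        ∀ U : (bg9Y (Matrix (Fin N) (Fin N) ℂ) (specialUnitaryUnits (Fin N)) x).Cfg,
          (bg9Y (Matrix (Fin N) (Fin N) ℂ) (specialUnitaryUnits (Fin N)) x).Reg335 c35Y α₀ U → IneqSupF (ops x).Kdiff B₁ δ₁ (fun _ => True) (fun _ _ => 1) U)
    -- the remaining printed leaves, verbatim
    (t310 : B9.Thm310Printed c35Y geo9Y (bg9Y (Matrix (Fin N) (Fin N) ℂ) (specialUnitaryUnits (Fin N))) (fun x => (ops x).E310))
    (t311 : B9.Thm311Printed c35Y geo9Y (bg9Y (Matrix (Fin N) (Fin N) ℂ) (specialUnitaryUnits (Fin N))) (fun x => (ops x).PosDef))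
    (t312 : B9.Thm312Printed (θ.d₆ + 1) c35Y geo9Y (bg9Y (Matrix (Fin N) (Fin N) ℂ) (specialUnitaryUnits (Fin N))) (fun x => (ops x).GD)
      (fun x => (ops x).G₁) (fun x => (ops x).H) (fun x => (ops x).H₁) (fun x => (ops x).HasRWExp) (fun x => (ops x).HasRWExpH)
      (fun x => (ops x).PosDefK))
    (t313 : B9.Thm313Printed c35Y geo9Y (bg9Y (Matrix (Fin N) (Fin N) ℂ) (specialUnitaryUnits (Fin N))) (fun x => (ops x).GG)
      (fun x => (ops x).HasRWExp) (fun x => (ops x).PosDefK))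
    (t315 : B9.Thm315FullPrinted c35Y geo9Y (bg9Y (Matrix (Fin N) (Fin N) ℂ) (specialUnitaryUnits (Fin N))) (fun x => (ops x).Ck) inΛY unitDistY
      (fun x => (ops x).GivenBy3185) (fun x => (ops x).HasRWExpC))
    -- in place of `s349`: n06-i's (3.25) dictionary + the three record-geometry facts (row 25)
    (hdict : ∀ x : MemberY θ.d₆ θ.ℓ₆ θ.hd' θ.hL' θ.b₀ θ.b₁ Mstar, Dict349 (ops x).Gp (ops x).Cinv (ops x).P349)
    (D349 : ∀ x : MemberY θ.d₆ θ.ℓ₆ θ.hd' θ.hL' θ.b₀ θ.b₁ Mstar, DistOK (geo9Y x))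
    {R₀ : ℝ} (hR₀ : 0 < R₀) (hgap : LevelGap (geo9Y (d := θ.d₆) (ℓ := θ.ℓ₆) (hd := θ.hd') (hL := θ.hL') (b₀ := θ.b₀) (b₁ := θ.b₁) (Mstar := Mstar)) R₀)
    (h261row : RowSum261 (geo9Y (d := θ.d₆) (ℓ := θ.ℓ₆) (hd := θ.hd') (hL := θ.hL') (b₀ := θ.b₀) (b₁ := θ.b₁) (Mstar := Mstar)))
    (t314loc : Thm314LocalPrinted c35Y geo9Y (bg9Y (Matrix (Fin N) (Fin N) ℂ) (specialUnitaryUnits (Fin N))) (fun x => (ops x).Kdiff) OmKY dOmegaY)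
    (P : B12.RunParams) : Dag.B9_main (leavesP w P) := by
  -- signs of the record's k-level tori for row 26's carrier facts
  have hMh : ∀ x : MemberY θ.d₆ θ.ℓ₆ θ.hd' θ.hL' θ.b₀ θ.b₁ Mstar, 1 ≤ x.Mh := fun x => le_trans (by norm_num) x.hM8
  have hP : ∀ x : MemberY θ.d₆ θ.ℓ₆ θ.hd' θ.hL' θ.b₀ θ.b₁ Mstar, ∀ μ, 1 ≤ x.P' μ := fun x μ => le_trans (by norm_num) (x.hP5 μ)
  have hsymm : ∀ (x : MemberY θ.d₆ θ.ℓ₆ θ.hd' θ.hL' θ.b₀ θ.b₁ Mstar) (y y' : (geo9Y x).Site), (geo9Y x).dist y y' = (geo9Y x).dist y' y := fun x y y' => by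
    show (((B6Geom246MultiLevelTorus.bondT x.D).dist (β x.hN x.D x.hk y) (β x.hN x.D x.hk y') : ℕ) : ℝ) = _
    rw [SimpleGraph.dist_comm]; rfl
  have hzero : ∀ (x : MemberY θ.d₆ θ.ℓ₆ θ.hd' θ.hL' θ.b₀ θ.b₁ Mstar) (y : (geo9Y x).Site), (geo9Y x).dist y y = 0 := fun x y => distT_self x.toKIdx (β x.hN x.D x.hk y)
  have htri : ∀ (x : MemberY θ.d₆ θ.ℓ₆ θ.hd' θ.hL' θ.b₀ θ.b₁ Mstar) (a b c : (geo9Y x).Site), (geo9Y x).dist a c ≤ (geo9Y x).dist a b + (geo9Y x).dist b c :=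
    fun x a b c => (B6Geom246MultiLevelTorus.triangle_refl_nonneg_T x.D (hMh x) (hP x)).1 (β x.hN x.D x.hk a) (β x.hN x.D x.hk b) (β x.hN x.D x.hk c)
  have hlen : ∀ (x : MemberY θ.d₆ θ.ℓ₆ θ.hd' θ.hL' θ.b₀ θ.b₁ Mstar) (y : (geo9Y x).Site), 0 ≤ (geo9Y x).len y := fun x y => (len_pos x.toKIdx y).le
  -- rows 4–8
  have hGA_e := hGA_e_of_pin (GA := fun x => (ops x).GA) hpinGA hAtOne
  have hGA_h1 := hGA_h1_of_pin (GA := fun x => (ops x).GA) hpinGA hAtOne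
  have hGA_e4 := hGA_e4_of_pin (GA := fun x => (ops x).GA) hpinGA hAtOne
  have hGA_h2 := hGA_h2_of_pin (GA := fun x => (ops x).GA) hpinGA hAtOne
  have hGA_l2 := hGA_l2_of_pin (GA := fun x => (ops x).GA) hpinGA hAtOne
  -- rows 11–12
  have hGp := hGp_of_blocksOn_of_null ops hGp_h1 hnullL2 hnullG hnullE4 hnullH2 hGpL2 hGpG hGpH1 hGpE4 hGpH2
  have hnullGA : ∀ (x : MemberY θ.d₆ θ.ℓ₆ θ.hd' θ.hL' θ.b₀ θ.b₁ Mstar) (n : Fin 4) (lam : (geo9Y x).Loc) (γ : ℝ), ¬ (lam.isRight = true) →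
      (ops x).GA.glob n (bg9Y (Matrix (Fin N) (Fin N) ℂ) (specialUnitaryUnits (Fin N)) x).one lam γ ≤ 0 := fun x n lam γ hlam => by
    rw [hpinGA x]
    cases lam with
    | inl f => exact le_of_eq rfl
    | inr J => exact absurd rfl hlam
  have hGA := hGA_of_globOn_of_null ops hnullGA hGAG
  -- rows 15–16 at the literal pin
  have hfun39 : (fun x => (ops x).EK39) = fun x => EK39OfOps (𝔬39 x) (rd39 x) (θ.d₆ + 1) (2 * (N39 * B39) * B6.c1 (θ.d₆ + 1) r39 α') ((1 - α') * r39) :=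
    funext hEK39
  have t39 : B9.Thm39Printed (θ.d₆ + 1) c35Y geo9Y (bg9Y (Matrix (Fin N) (Fin N) ℂ) (specialUnitaryUnits (Fin N))) (fun x => (ops x).EK39) := by
    rw [hfun39]
    exact thm39Printed_of_local348 𝔬39 rd39 R39 H39 (θ.d₆ + 1) α39 α' r39 δ39 θ39 B39 N39 a39 M39 ML39 c35Y_pos h39α h39α1 hα' hr39 hrδ39 hδ39 hθ39
      hB39 hN39 ha39 hM39 hst39 hloc39 h261_39 h39
  have hksum : B9.RWKernelSumYields (θ.d₆ + 1) geo9Y (bg9Y (Matrix (Fin N) (Fin N) ℂ) (specialUnitaryUnits (Fin N))) (fun x => (ops x).EK39) (fun x => (ops x).Cinv) :=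
    rwKernelSumYields_of_conv348 𝔬39 (fun x => (ops x).Cinv) (θ.d₆ + 1) hB₁39 hδ₁39 (fun x U h => by rw [hEK39 x] at h; exact h) hrdC
  -- row 26
  have s3132 : B9.Stmt3132Printed (θ.d₆ + 1) c35Y geo9Y (bg9Y (Matrix (Fin N) (Fin N) ℂ) (specialUnitaryUnits (Fin N))) (fun x => (ops x).QGQinv) (fun x => (ops x).QG1Qinv) :=
    stmt3132Printed_of_coercive (θ.d₆ + 1) hCT hCT₁ hN32 hN32₁ hsymm hzero htri hlen hA32 hwt
  exact b9_main_of_up_view₁₁B10YZW_of_obligations_W38T314SectBnHgEHS349supplied θ hθ Mstar ops ζ lamW w hup hGp_e hGp_h1 hC hGA_e hGA_h1 hGA_e4 hGA_h2 hGA_l2 hGp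
    hGA hA hEp hLp hGlp hH1p hE4p hH2p hK hEa hLa hGla hH1a hE4a hH2a 𝔬 rd R H κ d α ρ Nc N' Cℓ K θ₀ B₀ δ₀ a₁ M₁ ML hα hα2 hN hN' hCℓ hK0 hθ₀ hB₀ hδ₀ ha₁ hM₁
    hst hκ hrd hloc h261 h36 hE38 evY hco0 hco1 hco2 hco3 hB₁ hδ₁ hCB hδ₁le hrest h310 r hgeo hplain t39 t310 hksum t311 t312 t313 t315 hdict D349 hR₀ hgap h261row
    s3132 t314loc P

end Pointed

end Summit.QuantumFields.YangMills.BalabanUVNodes.N06AtRecord11ObligationsBatch2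

end
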